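import Literature.Barriers.RiemannHypothesis.TuranPartialSumsWindowArith
import Mathlib.NumberTheory.PrimeCounting
import HarnessLib

/-!
# Sections of `ζ` beyond `σ = 1`: soundness of the window checker, II (bins and chunks)

Barrier catalogue `Literature/Barriers/RiemannHypothesis/`, companion of
`TuranPartialSumsWindowCheck.lean` (step U3 of the plan to prove `TuranPartialSums`). The meaning of
one chunk of the window checker: if `(chunkOut P E piTab c).ok = true` (and the prime-count table is
correct up to the index `i_X`), then the output record bounds the bin sums over the chunk's range
`(g_stop, g_top]` — for a table chunk the prime sums `∑_p |H_{⌊N₁/p⌋}|/p` (from below, `Rtab`) and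
`∑_p p^{-s} H_{⌊N₁/p⌋}` (a box, `P0`); for an envelope chunk the integer sums
`∑_n |H|/(n log n)` (below, `mainm`), `∑_n |H|/((n−1) log n)` (above, `mainM`), the variation term
`R2`, the box of `∑_n n^{-s}H_{⌊N₁/n⌋}/log n`, the transition weight `GX` — and its flag certifies the
monotonicity of `|H_k|` on the chunk's `k`-range (`chunkOut_sound`). Everything here is PROVED.

## References

* [PlattTrudgian2016] D. J. Platt, T. S. Trudgian, LMS J. Comput. Math. 19 (2016), §2.
-/

noncomputable section

open Literature.Analysis.ValidatedNumerics.Numerics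
open Complex Finset

namespace Literature.Barriers.RiemannHypothesis.TuranWindow

/-! ### The mathematical quantities of a window -/

/-- `τ = tn/td`. [folklore] -/
def τOf (P : WinParams) : ℝ := (P.tn : ℝ) / P.td

/-- `N₁ = g_{i₁}`. [folklore] -/
def N1Of (P : WinParams) : ℕ := gridPt P.i1

/-- `k(n) = ⌊N₁/n⌋`. [folklore] -/
def kOf (P : WinParams) (n : ℕ) : ℕ := N1Of P / n

/-- `H_k(s)`, `s = 1 + iτ`. [folklore] -/
def Hk (P : WinParams) (k : ℕ) : ℂ := zetaPartialSum k (sOf (τOf P))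

/-- The primes of the bin `(u, v]`. [folklore] -/
def binPrimes (u v : ℕ) : Finset ℕ := (Finset.Ioc u v).filter Nat.Prime

/-- `p^{-s} H_{k(p)}(s)` (table term of `P₀`). [folklore] -/
def tabTermP (P : WinParams) (p : ℕ) : ℂ := (p : ℂ) ^ (-(sOf (τOf P))) * Hk P (kOf P p)

/-- `|H_{k(p)}|/p` (table term of `R`). [folklore] -/
def tabTermR (P : WinParams) (p : ℕ) : ℝ := ‖Hk P (kOf P p)‖ / p

/-- `n^{-s} H_{k(n)}(s)/log n` (envelope main term of `P₀`). [folklore] -/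
def envTermP (P : WinParams) (n : ℕ) : ℂ :=
  (n : ℂ) ^ (-(sOf (τOf P))) * Hk P (kOf P n) / (Real.log n : ℂ)

/-- `|H_{k(n)}|/(n log n)`. [folklore] -/
def envTermm (P : WinParams) (n : ℕ) : ℝ := ‖Hk P (kOf P n)‖ / (n * Real.log n)

/-- `|H_{k(n)}|/((n−1) log n)`. [folklore] -/
def envTermM (P : WinParams) (n : ℕ) : ℝ := ‖Hk P (kOf P n)‖ / ((n - 1) * Real.log n)

/-- `|H_{k(n+1)}|·(1/log n − 1/log(n+1))`. [folklore] -/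
def envTermR2 (P : WinParams) (n : ℕ) : ℝ :=
  ‖Hk P (kOf P (n + 1))‖ * (1 / Real.log n - 1 / Real.log (n + 1))

/-- Correctness of the prime-count table up to the index `iX`: `piTab[i] = π(g_i)`. [folklore] -/
def PiTabOK (piTab : List ℕ) (iX : ℕ) : Prop :=
  ∀ i, i ≤ iX → i < piTab.length → piTab.getD i 0 = Nat.primeCounting (gridPt i)

/-! ### Small lemmas -/

/-- `Ioc u v` of naturals as a difference of ranges, for counting primes. [folklore] -/
theorem card_binPrimes {u v : ℕ} (huv : u ≤ v) :
    (binPrimes u v).card = Nat.primeCounting v - Nat.primeCounting u := by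
  have h1 : ∀ n : ℕ, Nat.primeCounting n = ((Finset.range (n + 1)).filter Nat.Prime).card := by
    intro n
    rw [Nat.primeCounting, Nat.primeCounting', Nat.count_eq_card_filter_range]
  rw [h1, h1]
  have hsub : (Finset.range (u + 1)).filter Nat.Prime ⊆ (Finset.range (v + 1)).filter Nat.Prime := by
    apply Finset.filter_subset_filter
    exact Finset.range_subset_range.2 (by omega)
  rw [← Finset.card_sdiff_of_subset hsub]
  congr 1
  ext p
  simp only [binPrimes, Finset.mem_filter, Finset.mem_Ioc, Finset.mem_sdiff, Finset.mem_range]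
  constructor
  · rintro ⟨⟨h1, h2⟩, hp⟩; exact ⟨⟨by omega, hp⟩, fun h ↦ by omega⟩
  · rintro ⟨⟨h1, hp⟩, h2⟩
    refine ⟨⟨?_, by omega⟩, hp⟩
    by_contra h
    exact h2 ⟨by omega, hp⟩

/-- A sum of `c` members of an interval lies in `c` times the interval. [folklore] -/
theorem FImem_sum_mulInt {ι : Type*} (S : Finset ι) {x : ι → ℝ} {I : FI}
    (hx : ∀ i ∈ S, FI.mem (x i) I) : FI.mem (∑ i ∈ S, x i) (I.mulInt S.card) := by
  classical
  induction S using Finset.induction_on with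
  | empty =>
    simp only [Finset.sum_empty, Finset.card_empty, Nat.cast_zero]
    simp [FI.mem_def, FI.mulInt]
  | insert a S ha ih =>
    rw [Finset.sum_insert ha, Finset.card_insert_of_notMem ha]
    have h1 := hx a (Finset.mem_insert_self a S)
    have h2 := ih (fun i hi ↦ hx i (Finset.mem_insert_of_mem hi))
    rw [FI.mem_def] at h1 h2 ⊢
    have hnn : (0 : ℤ) ≤ (S.card : ℤ) := by positivity
    have hnn' : (0 : ℤ) ≤ ((S.card + 1 : ℕ) : ℤ) := by positivity
    simp only [FI.mulInt, hnn, ↓reduceIte] at h2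
    simp only [FI.mulInt, hnn', ↓reduceIte]
    push_cast at h2 ⊢
    constructor <;> nlinarith [h1.1, h1.2, h2.1, h2.2]

/-- The same for boxes. [folklore] -/
theorem CBmem_sum_mulInt {ι : Type*} (S : Finset ι) {z : ι → ℂ} {B : CB}
    (hz : ∀ i ∈ S, CB.mem (z i) B) : CB.mem (∑ i ∈ S, z i) (B.mulInt S.card) := by
  refine ⟨?_, ?_⟩
  · rw [Complex.re_sum]; exact FImem_sum_mulInt S (fun i hi ↦ (hz i hi).1)
  · rw [Complex.im_sum]; exact FImem_sum_mulInt S (fun i hi ↦ (hz i hi).2)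

/-- **Weighted sums**: nonnegative weights `c_i` with `∑ c_i ∈ μ`, values `y_i ∈ I` (and some
`y₀ ∈ I`): `∑ c_i y_i ∈ I·μ`. [folklore] -/
theorem FImem_weightedSum {ι : Type*} (S : Finset ι) {c y : ι → ℝ} {I μ : FI} {y0 : ℝ}
    (hc : ∀ i ∈ S, 0 ≤ c i) (hy : ∀ i ∈ S, FI.mem (y i) I) (hy0 : FI.mem y0 I)
    (hC : FI.mem (∑ i ∈ S, c i) μ) : FI.mem (∑ i ∈ S, c i * y i) (I.mul μ) := by
  set C := ∑ i ∈ S, c i with hCdef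
  rcases eq_or_lt_of_le (Finset.sum_nonneg hc : 0 ≤ C) with hC0 | hCpos
  · -- all weights vanish
    have hall : ∀ i ∈ S, c i = 0 := fun i hi ↦
      (Finset.sum_eq_zero_iff_of_nonneg hc).1 hC0.symm i hi
    have : ∑ i ∈ S, c i * y i = y0 * C := by
      rw [show C = 0 from hC0.symm, mul_zero]
      exact Finset.sum_eq_zero (fun i hi ↦ by rw [hall i hi, zero_mul])
    rw [this]
    exact FI.mem_mul hy0 hC
  · set ybar := (∑ i ∈ S, c i * y i) / C with hybar
    have hmem : FI.mem ybar I := by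
      rw [FI.mem_def] at hy0 ⊢
      have hlo : ∀ i ∈ S, (I.lo : ℝ) * c i ≤ c i * y i * SC := fun i hi ↦ by
        have := (FI.mem_def.1 (hy i hi)).1; nlinarith [hc i hi]
      have hhi : ∀ i ∈ S, c i * y i * SC ≤ (I.hi : ℝ) * c i := fun i hi ↦ by
        have := (FI.mem_def.1 (hy i hi)).2; nlinarith [hc i hi]
      have h1 : (I.lo : ℝ) * C ≤ (∑ i ∈ S, c i * y i) * SC := by
        rw [hCdef, Finset.mul_sum, Finset.sum_mul]; exact Finset.sum_le_sum hlo
      have h2 : (∑ i ∈ S, c i * y i) * SC ≤ (I.hi : ℝ) * C := by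
        rw [hCdef, Finset.mul_sum, Finset.sum_mul]; exact Finset.sum_le_sum hhi
      rw [hybar]
      constructor
      · rw [div_mul_eq_mul_div, le_div_iff₀ hCpos]; linarith
      · rw [div_mul_eq_mul_div, div_le_iff₀ hCpos]; linarith
    have : ∑ i ∈ S, c i * y i = ybar * C := by
      rw [hybar, div_mul_cancel₀ _ hCpos.ne']
    rw [this]
    exact FI.mem_mul hmem hC

/-- The box version with complex values `z_i ∈ B` and real nonnegative weights. [folklore] -/
theorem CBmem_weightedSum {ι : Type*} (S : Finset ι) {c : ι → ℝ} {z : ι → ℂ} {B : CB} {μ : FI}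
    {z0 : ℂ} (hc : ∀ i ∈ S, 0 ≤ c i) (hz : ∀ i ∈ S, CB.mem (z i) B) (hz0 : CB.mem z0 B)
    (hC : FI.mem (∑ i ∈ S, c i) μ) : CB.mem (∑ i ∈ S, z i * (c i : ℂ)) (B.mulFI μ) := by
  refine ⟨?_, ?_⟩
  · rw [Complex.re_sum]
    have : ∑ i ∈ S, (z i * (c i : ℂ)).re = ∑ i ∈ S, c i * (z i).re :=
      Finset.sum_congr rfl fun i _ ↦ by simp [mul_comm]
    rw [this]
    exact FImem_weightedSum S hc (fun i hi ↦ (hz i hi).1) hz0.1 hC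
  · rw [Complex.im_sum]
    have : ∑ i ∈ S, (z i * (c i : ℂ)).im = ∑ i ∈ S, c i * (z i).im :=
      Finset.sum_congr rfl fun i _ ↦ by simp [mul_comm]
    rw [this]
    exact FImem_weightedSum S hc (fun i hi ↦ (hz i hi).2) hz0.2 hC

/-- `∑_{u<n≤v} 1/(n log n) ≥ (v − u)/(v log v)` (`2 ≤ u + 1`). [folklore] -/
theorem sum_inv_mul_log_ge {u v : ℕ} (hu : 2 ≤ u) (huv : u ≤ v) :
    ((v : ℝ) - u) / (v * Real.log v) ≤ ∑ n ∈ Finset.Ioc u v, 1 / ((n : ℝ) * Real.log n) := by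
  have hv : (2 : ℝ) ≤ v := by exact_mod_cast (hu.trans huv)
  have hlogv : 0 < Real.log v := Real.log_pos (by linarith)
  calc ((v : ℝ) - u) / (v * Real.log v) = ∑ _n ∈ Finset.Ioc u v, 1 / ((v : ℝ) * Real.log v) := by
        rw [Finset.sum_const, Nat.card_Ioc, nsmul_eq_mul, Nat.cast_sub huv]; ring
    _ ≤ ∑ n ∈ Finset.Ioc u v, 1 / ((n : ℝ) * Real.log n) := by
        refine Finset.sum_le_sum fun n hn ↦ ?_
        rw [Finset.mem_Ioc] at hn
        have hn2 : (2 : ℝ) < n := by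
          have : u + 1 ≤ n := hn.1
          have : (3 : ℝ) ≤ n := by exact_mod_cast (by omega : 3 ≤ n)
          linarith
        have hnv : (n : ℝ) ≤ v := by exact_mod_cast hn.2
        have hlogn : 0 < Real.log n := Real.log_pos (by linarith)
        apply one_div_le_one_div_of_le (by positivity)
        gcongr

/-- `∑_{u<n≤v} 1/(n log n) ≤ (v − u)/(u log u)` (`2 ≤ u`). [folklore] -/
theorem sum_inv_mul_log_le {u v : ℕ} (hu : 2 ≤ u) (huv : u ≤ v) :
    ∑ n ∈ Finset.Ioc u v, 1 / ((n : ℝ) * Real.log n) ≤ ((v : ℝ) - u) / (u * Real.log u) := by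
  have hu' : (2 : ℝ) ≤ u := by exact_mod_cast hu
  have hlogu : 0 < Real.log u := Real.log_pos (by linarith)
  calc ∑ n ∈ Finset.Ioc u v, 1 / ((n : ℝ) * Real.log n)
      ≤ ∑ _n ∈ Finset.Ioc u v, 1 / ((u : ℝ) * Real.log u) := by
        refine Finset.sum_le_sum fun n hn ↦ ?_
        rw [Finset.mem_Ioc] at hn
        have hun : (u : ℝ) ≤ n := by exact_mod_cast (by omega : u ≤ n)
        apply one_div_le_one_div_of_le (by positivity)
        gcongr
    _ = ((v : ℝ) - u) / (u * Real.log u) := by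
        rw [Finset.sum_const, Nat.card_Ioc, nsmul_eq_mul, Nat.cast_sub huv]; ring

/-- `∑_{u<n≤v} 1/((n−1) log n) ≤ (v − u)/(u log u)` (`2 ≤ u`). [folklore] -/
theorem sum_inv_pred_mul_log_le {u v : ℕ} (hu : 2 ≤ u) (huv : u ≤ v) :
    ∑ n ∈ Finset.Ioc u v, 1 / (((n : ℝ) - 1) * Real.log n) ≤ ((v : ℝ) - u) / (u * Real.log u) := by
  have hu' : (2 : ℝ) ≤ u := by exact_mod_cast hu
  have hlogu : 0 < Real.log u := Real.log_pos (by linarith)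
  calc ∑ n ∈ Finset.Ioc u v, 1 / (((n : ℝ) - 1) * Real.log n)
      ≤ ∑ _n ∈ Finset.Ioc u v, 1 / ((u : ℝ) * Real.log u) := by
        refine Finset.sum_le_sum fun n hn ↦ ?_
        rw [Finset.mem_Ioc] at hn
        have hun : (u : ℝ) ≤ (n : ℝ) - 1 := by
          have : ((u + 1 : ℕ) : ℝ) ≤ n := by exact_mod_cast hn.1
          push_cast at this; linarith
        have hun' : (u : ℝ) ≤ n := by linarith
        apply one_div_le_one_div_of_le (by positivity)
        gcongr
        · linarith
    _ = ((v : ℝ) - u) / (u * Real.log u) := by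
        rw [Finset.sum_const, Nat.card_Ioc, nsmul_eq_mul, Nat.cast_sub huv]; ring

/-- Telescoping: `∑_{n=u}^{v−1} (1/log n − 1/log(n+1)) = 1/log u − 1/log v`. [folklore] -/
theorem sum_Ico_inv_log_sub (u v : ℕ) (huv : u ≤ v) :
    ∑ n ∈ Finset.Ico u v, (1 / Real.log n - 1 / Real.log ((n : ℝ) + 1)) =
      1 / Real.log u - 1 / Real.log v := by
  induction v, huv using Nat.le_induction with
  | base => simp
  | succ n hn ih =>
    rw [Finset.sum_Ico_succ_top hn, ih]
    push_cast
    ring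

/-! ### The data of a bin and the facts about one `n` of the bin -/

/-- `k(n) ∈ [⌊N₁/v⌋, ⌊N₁/u⌋]` for `u < n ≤ v`. [folklore] -/
theorem kOf_mem {P : WinParams} {u v n : ℕ} (hu : 0 < u) (hn1 : u < n) (hn2 : n ≤ v) :
    N1Of P / v ≤ kOf P n ∧ kOf P n ≤ N1Of P / u := by
  unfold kOf
  exact ⟨Nat.div_le_div_left hn2 (by omega), Nat.div_le_div_left hn1.le hu⟩

/-- `log u ≤ log n ≤ log v` for `u < n ≤ v` (`u ≥ 1`). [folklore] -/
theorem log_mem {u v n : ℕ} (hu : 1 ≤ u) (hn1 : u < n) (hn2 : n ≤ v) :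
    Real.log u ≤ Real.log n ∧ Real.log n ≤ Real.log v := by
  constructor
  · exact Real.log_le_log (by exact_mod_cast hu) (by exact_mod_cast hn1.le)
  · exact Real.log_le_log (by exact_mod_cast (by omega : 0 < n)) (by exact_mod_cast hn2)

/-- `p^{-s} H = p⁻¹ · (phase · H)`. [folklore] -/
theorem tabTermP_eq {P : WinParams} {p : ℕ} (hp : 0 < p) :
    tabTermP P p = (phase (τOf P) (Real.log p) * Hk P (kOf P p)) * (((p : ℝ)⁻¹ : ℝ) : ℂ) := by
  unfold tabTermP
  rw [natCast_cpow_neg_sOf hp]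
  push_cast
  ring

/-- `n^{-s} H/log n = (phase · H) · (1/(n log n))`. [folklore] -/
theorem envTermP_eq {P : WinParams} {n : ℕ} (hn : 0 < n) :
    envTermP P n = (phase (τOf P) (Real.log n) * Hk P (kOf P n)) *
      ((1 / ((n : ℝ) * Real.log n) : ℝ) : ℂ) := by
  unfold envTermP
  rw [natCast_cpow_neg_sOf hn]
  push_cast
  ring

/-! ### The invariant of the bin walk -/

/-- The table values for the indices `a, a+1, …` read downwards: `pisList piTab a i = [π_i-data]`:
the list `[piTab[i−1], …, piTab[a]]`. [folklore] -/
def pisList (piTab : List ℕ) (a i : ℕ) : List ℕ := ((piTab.drop a).take (i - a)).reverse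

/-- [folklore] -/
theorem pisList_self (piTab : List ℕ) (a : ℕ) : pisList piTab a a = [] := by simp [pisList]

/-- [folklore] -/
theorem pisList_succ (piTab : List ℕ) {a i : ℕ} (hai : a ≤ i) (hi : i < piTab.length) :
    pisList piTab a (i + 1) = piTab.getD i 0 :: pisList piTab a i := by
  unfold pisList
  rw [show i + 1 - a = (i - a) + 1 by omega, List.take_add_one, List.reverse_append]
  have : (List.drop a piTab)[i - a]? = some (piTab.getD i 0) := by
    rw [List.getElem?_drop, show a + (i - a) = i by omega, List.getD_eq_getElem?_getD,
      List.getElem?_eq_getElem hi]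
    simp
  rw [this]
  simp

/-- The accumulated bounds of the walk over the processed range `(g_i, g_top]` (all reals scaled by
`2^48`): table chunks (`tab = true`) bound the prime sums, envelope chunks the integer sums.
[folklore] -/
structure AccBounds (P : WinParams) (E : EnvConsts) (tab : Bool) (lo hi : ℕ) (o : ChunkOut) : Prop where
  /-- all checks passed -/
  ok : o.ok = true
  /-- `Rtab ≤ ∑_p |H_{k(p)}|/p` -/
  Rtab : tab = true → (o.Rtab : ℝ) ≤ (∑ p ∈ binPrimes lo hi, tabTermR P p) * SC
  /-- `Rtab ≥ 0` -/
  Rtab0 : 0 ≤ o.Rtab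
  /-- `Rtab = 0` on envelope chunks -/
  RtabE : tab = false → o.Rtab = 0
  /-- `P0 ∋ ∑_p p^{-s}H` (table) -/
  P0T : tab = true → CB.mem (∑ p ∈ binPrimes lo hi, tabTermP P p) o.P0
  /-- `P0 ∋ ∑_n n^{-s}H/log n` (envelope) -/
  P0E : tab = false → CB.mem (∑ n ∈ Finset.Ioc lo hi, envTermP P n) o.P0
  /-- `mainm ≤ ∑ |H|/(n log n)` -/
  mainm : tab = false → (o.mainm : ℝ) ≤ (∑ n ∈ Finset.Ioc lo hi, envTermm P n) * SC
  /-- `0 ≤ mainm` -/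
  mainm0 : 0 ≤ o.mainm
  /-- `mainm = 0` on table chunks -/
  mainmT : tab = true → o.mainm = 0
  /-- `∑ |H|/((n−1) log n) ≤ mainM` -/
  mainM : tab = false → (∑ n ∈ Finset.Ioc lo hi, envTermM P n) * SC ≤ (o.mainM : ℝ)
  /-- `0 ≤ mainM` -/
  mainM0 : 0 ≤ o.mainM
  /-- `mainM = 0` on table chunks -/
  mainMT : tab = true → o.mainM = 0
  /-- `∑ |H_{k(n+1)}|(1/log n − 1/log(n+1)) ≤ R2` -/
  R2 : tab = false → (∑ n ∈ Finset.Ico lo hi, envTermR2 P n) * SC ≤ (o.R2 : ℝ)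
  /-- `0 ≤ R2` -/
  R20 : 0 ≤ o.R2
  /-- `R2 = 0` on table chunks -/
  R2T : tab = true → o.R2 = 0
  /-- the transition weight (envelope chunk starting at `X`) -/
  GX : tab = false → lo = gridPt (max E.iX P.iY) → lo < hi →
    ‖Hk P (kOf P (lo + 1))‖ / Real.log ((lo : ℝ) + 1) * SC ≤ (o.GX : ℝ)
  /-- `0 ≤ GX` -/
  GX0 : 0 ≤ o.GX
  /-- monotonicity certificate on the `k`-range of the processed bins -/
  mono : o.allMono = true → ∀ j, N1Of P / hi < j → P.k0 < j → j ≤ N1Of P / lo →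
    ‖Hk P (j - 1)‖ ≤ ‖Hk P j‖
  /-- monotonicity certificate of the table (chunks whose first `k` is below `k₀`) -/
  monoTab : o.allMono = true → N1Of P / hi < P.k0 → ∀ j, 2 ≤ j → j ≤ P.k0 →
    ‖Hk P (j - 1)‖ ≤ ‖Hk P j‖
  /-- the largest `k` -/
  kcert : o.kcert = N1Of P / lo

/-! ### Monotonicity from the sign test -/

/-- If `Re(H_{j−1} · conj(j^{-iτ})) ≥ 0` then `‖H_{j−1}‖ ≤ ‖H_j‖`. [folklore] -/
theorem norm_Hk_pred_le {P : WinParams} {j : ℕ} (hj : 1 ≤ j)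
    (hre : 0 ≤ (Hk P (j - 1) * starRingEnd ℂ (phase (τOf P) (Real.log j))).re) :
    ‖Hk P (j - 1)‖ ≤ ‖Hk P j‖ := by
  have hjeq : j = (j - 1) + 1 := by omega
  have hHk : Hk P j = Hk P (j - 1) + (j : ℂ) ^ (-(sOf (τOf P))) := by
    unfold Hk
    conv_lhs => rw [hjeq, zetaPartialSum_succ']
    rw [Nat.sub_add_cancel hj]
  have hks : (j : ℂ) ^ (-(sOf (τOf P))) = ((j : ℂ))⁻¹ * phase (τOf P) (Real.log j) :=
    natCast_cpow_neg_sOf (by omega) _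
  set A := Hk P (j - 1)
  set w := (j : ℂ) ^ (-(sOf (τOf P)))
  have hsq : ‖A + w‖ ^ 2 = ‖A‖ ^ 2 + 2 * (A * starRingEnd ℂ w).re + ‖w‖ ^ 2 := by
    rw [Complex.sq_norm, Complex.sq_norm, Complex.sq_norm, Complex.normSq_add]
    simp only [Complex.mul_re, Complex.conj_re, Complex.conj_im]
    ring
  have hre' : 0 ≤ (A * starRingEnd ℂ w).re := by
    rw [hks, map_mul]
    have : starRingEnd ℂ (((j : ℂ))⁻¹) = ((j : ℂ))⁻¹ := by rw [map_inv₀, Complex.conj_natCast]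
    rw [this, ← mul_assoc, mul_comm A, mul_assoc]
    rw [show ((j : ℂ))⁻¹ = (((j : ℝ)⁻¹ : ℝ) : ℂ) by push_cast; rfl, Complex.re_ofReal_mul]
    exact mul_nonneg (by positivity) hre
  rw [hHk]
  have : ‖A‖ ^ 2 ≤ ‖A + w‖ ^ 2 := by rw [hsq]; nlinarith [norm_nonneg w, sq_nonneg ‖w‖]
  exact (pow_le_pow_iff_left₀ (norm_nonneg _) (norm_nonneg _) two_ne_zero).1 this

/-! ### The invariant of the bin walk -/

/-- The hypotheses on a chunk that the bin walk uses: the parameters, the table of `H_k` (when the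
chunk's `k`-range reaches below `k₀`), the phase of `k₀`, the claimed `Hk0`, the prime-count table,
and the chunk boundaries. [folklore] -/
structure ChunkCtx (P : WinParams) (E : EnvConsts) (piTab : List ℕ) (tab : List CB) (Ψ0 : CB)
    (top stop : ℕ) : Prop where
  /-- `0 < td` -/
  td_pos : 0 < P.td
  /-- `0 < tn` -/
  tn_pos : 0 < P.tn
  /-- `1 ≤ k₀` -/
  k0_pos : 1 ≤ P.k0
  /-- the table of `H_k`, when the first `k` of the chunk is below `k₀` -/
  tabOK : N1Of P / gridPt top < P.k0 →
    ∀ k, 1 ≤ k → k ≤ P.k0 → CB.mem (Hk P k) (hTabGet tab P.k0 k)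
  /-- `Ψ₀ ∋ k₀^{-iτ}` -/
  psi0 : CB.mem (phase (τOf P) (Real.log P.k0)) Ψ0
  /-- `Hk0 ∋ H_{k₀}(s)` -/
  hk0 : CB.mem (Hk P P.k0) P.Hk0
  /-- the prime-count table is correct up to `i_X` -/
  pi : PiTabOK piTab E.iX
  /-- a table chunk lies below `i_X` and inside the table, an envelope chunk above `i_X` -/
  region : (top ≤ E.iX ∧ top < piTab.length) ∨ E.iX ≤ stop
  /-- the chunk boundaries -/
  bounds : P.iY ≤ stop ∧ stop < top ∧ top ≤ P.i1

/-- The invariant of the state of the bin walk of a chunk (`tabChunk = (top ≤ i_X)`). [folklore] -/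
structure BinInv (P : WinParams) (E : EnvConsts) (piTab : List ℕ) (top stop : ℕ) (st : BinState) :
    Prop where
  /-- the index -/
  i_mem : stop ≤ st.i ∧ st.i ≤ top
  /-- `v = g_i` -/
  v_eq : st.v = gridPt st.i
  /-- `Lv ∋ log v` -/
  Lv : FI.mem (Real.log st.v) st.Lv
  /-- `Φv ∋ v^{-iτ}` -/
  Φv : CB.mem (phase (τOf P) (Real.log st.v)) st.Φv
  /-- `k = ⌊N₁/v⌋` -/
  k_eq : st.k = N1Of P / st.v
  /-- `0 < k` -/
  k_pos : 0 < st.k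
  /-- `Lk ∋ log k` -/
  Lk : FI.mem (Real.log st.k) st.Lk
  /-- `Ψk ∋ k^{-iτ}` when maintained -/
  Ψk : st.kph = true → CB.mem (phase (τOf P) (Real.log st.k)) st.Ψk
  /-- the remaining lower edges -/
  edges : st.edges = gridDesc stop st.i
  /-- the table value at `g_i` (table chunks) -/
  piv : top ≤ E.iX → st.piv = Nat.primeCounting st.v
  /-- the remaining table values (table chunks) -/
  pis : top ≤ E.iX → st.pis = pisList piTab stop st.i
  /-- the accumulated bounds -/
  acc : AccBounds P E (decide (top ≤ E.iX)) st.v (gridPt top) st.out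

/-! ### The pieces of a bin step -/

section Pieces

variable {P : WinParams} {E : EnvConsts} {piTab : List ℕ} {tab : List CB} {Ψ0 : CB} {top stop : ℕ}

/-- Positivity of a grid point. [folklore] -/
theorem gridPt_pos (i : ℕ) : 0 < gridPt i := lt_of_lt_of_le (by norm_num) (twenty_le_gridPt i)

/-- [folklore] -/
theorem lt_of_ble_false {a b : ℕ} (h : Nat.ble a b = false) : b < a := by
  by_contra hc
  have : Nat.ble a b = true := by rw [Nat.ble_eq]; omega
  rw [h] at this; simp at this

/-- [folklore] -/
theorem le_of_blt_false {a b : ℕ} (h : Nat.blt a b = false) : b ≤ a := by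
  by_contra hc
  have : Nat.blt a b = true := by rw [Nat.blt_eq]; omega
  rw [h] at this; simp at this

/-- `log a ≤ log j ≤ log b` for `0 < a ≤ j ≤ b`. [folklore] -/
theorem log_mem' {a j b : ℕ} (ha : 0 < a) (haj : a ≤ j) (hjb : j ≤ b) :
    Real.log a ≤ Real.log j ∧ Real.log j ≤ Real.log b :=
  ⟨Real.log_le_log (by exact_mod_cast ha) (by exact_mod_cast haj),
    Real.log_le_log (by exact_mod_cast (lt_of_lt_of_le ha haj)) (by exact_mod_cast hjb)⟩

/-- **The `H`-box.** For `1 ≤ k ≤ k'`: if the table is sound whenever `k < k₀`, the phases of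
`[k, k']` lie in `Ψrange` whenever the range is not inside the table region, `Hk0 ∋ H_{k₀}` and
`Ψ₀ ∋ k₀^{-iτ}`, then `hboxOf ∋ H_j(s)` for every `j ∈ [k, k']`. [folklore] -/
theorem mem_hboxOf (htd : 0 < P.td) (htn : 0 < P.tn) (hk0 : 1 ≤ P.k0) {Ψrange : CB} {k k' : ℕ}
    (hk : 1 ≤ k) (hkk' : k ≤ k')
    (htab : k < P.k0 → ∀ j, 1 ≤ j → j ≤ P.k0 → CB.mem (Hk P j) (hTabGet tab P.k0 j))
    (hΨ : ¬ (k' ≤ P.k0 ∧ k < P.k0) → ∀ y, Real.log k ≤ y → y ≤ Real.log k' →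
      CB.mem (phase (τOf P) y) Ψrange)
    (hHk0 : CB.mem (Hk P P.k0) P.Hk0) (hΨ0 : CB.mem (phase (τOf P) (Real.log P.k0)) Ψ0)
    {j : ℕ} (hj1 : k ≤ j) (hj2 : j ≤ k') : CB.mem (Hk P j) (hboxOf P tab Ψ0 Ψrange k k') := by
  unfold hboxOf
  have hem : P.k0 ≤ j → ¬ (k' ≤ P.k0 ∧ k < P.k0) →
      CB.mem (Hk P j) (emBox P.tn P.td P.k0 P.Hk0 Ψrange Ψ0) := fun hj0 hnot ↦ by
    have hlj := log_mem' (by omega) hj1 hj2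
    exact mem_emBox htn htd hk0 hj0 hHk0 (hΨ hnot _ hlj.1 hlj.2) hΨ0
  cases hc1 : Nat.ble P.k0 k
  · simp only [Bool.cond_false]
    have hklt : k < P.k0 := lt_of_ble_false hc1
    cases hc2 : Nat.ble k' P.k0
    · simp only [Bool.cond_false]
      have hk'gt : P.k0 < k' := lt_of_ble_false hc2
      rcases le_or_gt j P.k0 with hjle | hjgt
      · exact mem_hullCB_left (mem_hTabHull (htab hklt) hk hklt.le le_rfl hj1 hjle) _
      · exact mem_hullCB_right (hem hjgt.le (fun h ↦ absurd h.1 (by omega))) _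
    · simp only [Bool.cond_true]
      have hk'le : k' ≤ P.k0 := by simpa [Nat.ble_eq] using hc2
      exact mem_hTabHull (htab hklt) hk hkk' hk'le hj1 hj2
  · simp only [Bool.cond_true]
    have hkge : P.k0 ≤ k := by simpa [Nat.ble_eq] using hc1
    exact hem (hkge.trans hj1) (fun h ↦ absurd h.2 (by omega))

/-- **The `k`-phases.** [folklore] -/
theorem kphaseOf_spec (htd : 0 < P.td) {st : BinState} {k' : ℕ} {incrK : Option FI} {Lk' : FI}
    {Ψrange Ψk' : CB} {kph' : Bool}
    (h : kphaseOf P st k' incrK Lk' = some (Ψrange, Ψk', kph'))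
    (hLk : FI.mem (Real.log st.k) st.Lk) (hLk' : FI.mem (Real.log k') Lk')
    (hΨk : st.kph = true → CB.mem (phase (τOf P) (Real.log st.k)) st.Ψk)
    (hinc : ∀ D, incrK = some D → FI.mem (Real.log k' - Real.log st.k) D) :
    (¬ (k' ≤ P.k0 ∧ st.k < P.k0) →
      (∀ y, Real.log st.k ≤ y → y ≤ Real.log k' → CB.mem (phase (τOf P) y) Ψrange) ∧
        CB.mem (phase (τOf P) (Real.log k')) Ψk') ∧
    (kph' = true → CB.mem (phase (τOf P) (Real.log k')) Ψk') := by
  unfold kphaseOf at h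
  cases hin : (Nat.ble k' P.k0 && Nat.blt st.k P.k0)
  · rw [hin] at h
    simp only [Bool.cond_false] at h
    -- the starting phase
    split at h
    · simp at h
    · rename_i Ψs hstart
      have hΨs : CB.mem (phase (τOf P) (Real.log st.k)) Ψs := by
        cases hkp : st.kph
        · rw [hkp] at hstart
          simp only [Bool.cond_false] at hstart
          split at hstart
          · rename_i B hB
            simp only [Option.some.injEq] at hstart
            subst hstart
            rw [FI.mem_def] at hLk
            exact mem_phaseBox htd hB hLk.1 hLk.2
          · simp at hstart
        · rw [hkp] at hstart
          simp only [Bool.cond_true, Option.some.injEq] at hstart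
          rw [← hstart]; exact hΨk hkp
      split at h
      · rename_i Ψr Ψn hup
        simp only [Option.some.injEq, Prod.mk.injEq] at h
        obtain ⟨rfl, rfl, rfl⟩ := h
        obtain ⟨h1, h2⟩ := phaseUp_spec htd hup hΨs hLk hLk' hinc
        exact ⟨fun _ ↦ ⟨h1, h2⟩, fun _ ↦ h2⟩
      · simp at h
  · rw [hin] at h
    simp only [Bool.cond_true, Option.some.injEq, Prod.mk.injEq] at h
    obtain ⟨rfl, rfl, rfl⟩ := h
    have hyes : k' ≤ P.k0 ∧ st.k < P.k0 := by
      simpa [Bool.and_eq_true, Nat.ble_eq, Nat.blt_eq] using hin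
    exact ⟨fun hnot ↦ absurd hyes hnot, fun hf ↦ by simp at hf⟩

/-- **The monotonicity test.** [folklore] -/
theorem monoBinOf_spec {k k' : ℕ} {Hbox Ψrange : CB} (h : monoBinOf P k k' Hbox Ψrange = true)
    (hk : 0 < k) (hHbox : ∀ j, k ≤ j → j ≤ k' → CB.mem (Hk P j) Hbox)
    (hΨ : P.k0 < k' → ∀ y, Real.log k ≤ y → y ≤ Real.log k' → CB.mem (phase (τOf P) y) Ψrange)
    {j : ℕ} (hj1 : k ≤ j) (hj0 : P.k0 < j) (hj2 : j ≤ k') : ‖Hk P (j - 1)‖ ≤ ‖Hk P j‖ := by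
  unfold monoBinOf at h
  rw [Bool.or_eq_true, Nat.ble_eq, decide_eq_true_eq] at h
  rcases h with hle | htest
  · omega
  · set τ := τOf P
    have hlj := log_mem' hk hj1 hj2
    have hph := hΨ (by omega) _ hlj.1 hlj.2
    have hw : CB.mem (Hk P (j - 1)) (Hbox.widen (cdiv SCZ k)) := by
      refine CB.mem_widen (hHbox j hj1 hj2) ?_
      have hjeq : j = (j - 1) + 1 := by omega
      have hHj : Hk P j = Hk P (j - 1) + (j : ℂ) ^ (-(sOf τ)) := by
        unfold Hk
        conv_lhs => rw [hjeq, zetaPartialSum_succ']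
        rw [Nat.sub_add_cancel (by omega : 1 ≤ j)]
      have hnorm : ‖Hk P (j - 1) - Hk P j‖ = ((j : ℝ))⁻¹ := by
        rw [hHj, show Hk P (j - 1) - (Hk P (j - 1) + (j : ℂ) ^ (-(sOf τ))) =
          -((j : ℂ) ^ (-(sOf τ))) by ring, norm_neg]
        have := norm_ofReal_cpow_neg (sOf_re τ) (show (0 : ℝ) < (j : ℝ) by
          exact_mod_cast (by omega : 0 < j))
        rw [show ((j : ℝ) : ℂ) = (j : ℂ) by norm_cast] at this
        exact this
      rw [hnorm]
      have hjk : ((j : ℝ))⁻¹ ≤ ((k : ℝ))⁻¹ := inv_anti₀ (by exact_mod_cast hk) (by exact_mod_cast hj1)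
      have hc := le_cdiv_mul_real (a := SCZ) (b := k) (by exact_mod_cast hk)
      rw [SCZ_cast] at hc
      push_cast at hc
      have hkr : (0 : ℝ) < k := by exact_mod_cast hk
      calc ((j : ℝ))⁻¹ * SC ≤ ((k : ℝ))⁻¹ * SC := by gcongr
        _ ≤ (cdiv SCZ k : ℝ) := by rw [inv_mul_le_iff₀ hkr]; linarith
    have hprod := (CB.mem_mul hw (CB.mem_conj hph)).1
    rw [FI.mem_def] at hprod
    have h0 : (0 : ℝ) ≤ ((((Hbox.widen (cdiv SCZ k)).mul Ψrange.conj).re).lo : ℝ) := by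
      exact_mod_cast htest
    have hsc : (0 : ℝ) < SC := SC_pos
    exact norm_Hk_pred_le (by omega) (by nlinarith [hprod.1])

/-! ### Splitting the sums at `v` -/

/-- [folklore] -/
theorem binPrimes_split {u v hi : ℕ} (huv : u ≤ v) (hvh : v ≤ hi) {β : Type*} [AddCommMonoid β]
    (f : ℕ → β) :
    ∑ p ∈ binPrimes u hi, f p = ∑ p ∈ binPrimes u v, f p + ∑ p ∈ binPrimes v hi, f p := by
  unfold binPrimes
  rw [← Finset.sum_union]
  · congr 1
    rw [← Finset.filter_union, Finset.Ioc_union_Ioc_eq_Ioc huv hvh]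
  · exact Finset.disjoint_filter_filter (Finset.Ioc_disjoint_Ioc_of_le le_rfl)

/-- [folklore] -/
theorem Ioc_split {u v hi : ℕ} (huv : u ≤ v) (hvh : v ≤ hi) {β : Type*} [AddCommMonoid β]
    (f : ℕ → β) :
    ∑ n ∈ Finset.Ioc u hi, f n = ∑ n ∈ Finset.Ioc u v, f n + ∑ n ∈ Finset.Ioc v hi, f n := by
  rw [← Finset.sum_union (Finset.Ioc_disjoint_Ioc_of_le le_rfl), Finset.Ioc_union_Ioc_eq_Ioc huv hvh]

/-- [folklore] -/
theorem Ico_split {u v hi : ℕ} (huv : u ≤ v) (hvh : v ≤ hi) {β : Type*} [AddCommMonoid β]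
    (f : ℕ → β) :
    ∑ n ∈ Finset.Ico u hi, f n = ∑ n ∈ Finset.Ico u v, f n + ∑ n ∈ Finset.Ico v hi, f n := by
  rw [← Finset.sum_union (Finset.Ico_disjoint_Ico_consecutive u v hi),
    Finset.Ico_union_Ico_eq_Ico huv hvh]

/-! ### The update of the accumulators -/

/-- Floor division estimate: `((a / b : ℤ) : ℝ) ≤ x` whenever `a ≤ x·b` (`0 < b`). [folklore] -/
theorem cast_fdiv_le {a b : ℤ} {x : ℝ} (hb : 0 < b) (h : (a : ℝ) ≤ x * b) : ((a / b : ℤ) : ℝ) ≤ x := by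
  have := fdiv_mul_le_real (a := a) hb
  have hb' : (0 : ℝ) < b := by exact_mod_cast hb
  nlinarith

/-- Ceiling division estimate: `x ≤ cdiv a b` whenever `x·b ≤ a` (`0 < b`). [folklore] -/
theorem le_cast_cdiv {a b : ℤ} {x : ℝ} (hb : 0 < b) (h : x * b ≤ (a : ℝ)) : x ≤ ((cdiv a b : ℤ) : ℝ) := by
  have := le_cdiv_mul_real (a := a) hb
  have hb' : (0 : ℝ) < b := by exact_mod_cast hb
  nlinarith

/-- `0 ≤ cdiv a b` for `0 ≤ a`, `0 < b`. [folklore] -/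
theorem cdiv_nonneg {a b : ℤ} (ha : 0 ≤ a) (hb : 0 < b) : 0 ≤ cdiv a b := by
  have h := le_cast_cdiv (x := 0) hb (by simpa using (show (0 : ℝ) ≤ a by exact_mod_cast ha))
  exact_mod_cast h

set_option maxHeartbeats 1000000 in
/-- **The accumulators of one bin** `(u, v]` (in a walk whose processed range is `(v, hi]`): the data
`Z ∋ t^{-iτ}H_{k(t)}`, the modulus bounds, the logarithms, the prime count and the monotonicity flag
of the bin extend the bounds from `(v, hi]` to `(u, hi]`. [folklore] -/
theorem accUpdate_spec {tabC : Bool} {i u v hi c : ℕ} {o o' : ChunkOut} {Z : CB} {mlo Mhi : ℤ}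
    {Lu Lv : FI} {monoBin : Bool} {k' : ℕ}
    (h : accUpdate P E i u v c o Z mlo Mhi Lu Lv monoBin k' = some o')
    (hbranch : Nat.ble i E.iX = tabC) (hiX : i = max E.iX P.iY + 1 ↔ u = gridPt (max E.iX P.iY))
    (hacc : AccBounds P E tabC v hi o) (hu : 20 ≤ u) (huv : u < v) (hvh : v ≤ hi)
    (hz : ∀ n, u < n → n ≤ v → CB.mem (phase (τOf P) (Real.log n) * Hk P (kOf P n)) Z)
    (hm : ∀ n, u < n → n ≤ v → (mlo : ℝ) ≤ ‖Hk P (kOf P n)‖ * SC ∧ ‖Hk P (kOf P n)‖ * SC ≤ (Mhi : ℝ))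
    (hmlo0 : 0 ≤ mlo) (hLu : FI.mem (Real.log u) Lu) (hLv : FI.mem (Real.log v) Lv)
    (hc : tabC = true → c = Nat.primeCounting v - Nat.primeCounting u)
    (hmono : monoBin = true → ∀ j, N1Of P / v ≤ j → P.k0 < j → j ≤ N1Of P / u →
      ‖Hk P (j - 1)‖ ≤ ‖Hk P j‖)
    (hk' : k' = N1Of P / u) :
    AccBounds P E tabC u hi o' := by
  have hu0 : 0 < u := by omega
  have hu2 : 2 ≤ u := by omega
  have hsc : (0 : ℝ) < SC := SC_pos
  have hSCZ : (0 : ℤ) < SCZ := by norm_num [SCZ]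
  have hmlo0r : (0 : ℝ) ≤ mlo := by exact_mod_cast hmlo0
  have hMhi0 : (0 : ℝ) ≤ Mhi := le_trans (by positivity) (hm v huv le_rfl).2
  have hMhi0' : (0 : ℤ) ≤ Mhi := by exact_mod_cast hMhi0
  have hv2 : (2 : ℝ) < v := by
    have : (21 : ℝ) ≤ v := by exact_mod_cast (by omega : 21 ≤ v)
    linarith
  have hu2r : (2 : ℝ) < u := by
    have : (20 : ℝ) ≤ u := by exact_mod_cast hu
    linarith
  have hlogu : 0 < Real.log u := Real.log_pos (by linarith)
  have hlogv : 0 < Real.log v := Real.log_pos (by linarith)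
  have hloguv : Real.log u ≤ Real.log v :=
    Real.log_le_log (by positivity) (by exact_mod_cast huv.le)
  -- modulus bounds in real form
  have hHlo : ∀ n, u < n → n ≤ v → (mlo : ℝ) / SC ≤ ‖Hk P (kOf P n)‖ := fun n h1 h2 ↦ by
    rw [div_le_iff₀ hsc]; exact (hm n h1 h2).1
  have hHhi : ∀ n, u < n → n ≤ v → ‖Hk P (kOf P n)‖ ≤ (Mhi : ℝ) / SC := fun n h1 h2 ↦ by
    rw [le_div_iff₀ hsc]; exact (hm n h1 h2).2
  -- the combined monotonicity certificate
  have hmono' : (o.allMono && monoBin) = true → ∀ j, N1Of P / hi < j → P.k0 < j →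
      j ≤ N1Of P / u → ‖Hk P (j - 1)‖ ≤ ‖Hk P j‖ := by
    intro hb j hj1 hj0 hj2
    rw [Bool.and_eq_true] at hb
    rcases le_or_gt j (N1Of P / v) with hle | hgt
    · exact hacc.mono hb.1 j hj1 hj0 hle
    · exact hmono hb.2 j hgt.le hj0 hj2
  have hmonoTab' : (o.allMono && monoBin) = true → N1Of P / hi < P.k0 → ∀ j, 2 ≤ j → j ≤ P.k0 →
      ‖Hk P (j - 1)‖ ≤ ‖Hk P j‖ := fun hb ↦ by
    rw [Bool.and_eq_true] at hb
    exact hacc.monoTab hb.1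
  unfold accUpdate at h
  cases htc : tabC
  · ---------------------------------------------------------------- envelope bin
    rw [htc] at hbranch hacc
    rw [hbranch] at h
    simp only [Bool.cond_false] at h
    split at h
    rotate_left
    · simp at h
    rename_i μv μu iLu iLv1 hμv hμu hiLu hiLv1
    simp only [Option.some.injEq] at h
    subst h
    -- meaning of the four quotients
    have hμv' : FI.mem (((v : ℝ) - u) / (v * Real.log v)) μv := by
      have := FI.mem_divPos hμv (FI.mem_ofInt ((v : ℤ) - u)) (FI.mem_mulInt hLv v)
      push_cast at this
      convert this using 1; ring
    have hμu' : FI.mem (((v : ℝ) - u) / (u * Real.log u)) μu := by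
      have := FI.mem_divPos hμu (FI.mem_ofInt ((v : ℤ) - u)) (FI.mem_mulInt hLu u)
      push_cast at this
      convert this using 1; ring
    have hiLu' : FI.mem (1 / Real.log u) iLu := by
      have := FI.mem_divPos hiLu (FI.mem_ofInt 1) hLu
      simpa using this
    have hiLv1' : FI.mem (1 / (Real.log v + 1 / v)) iLv1 := by
      have := FI.mem_divPos hiLv1 (FI.mem_ofInt 1)
        (FI.mem_add hLv (FI.mem_ofFrac 1 (by omega : 0 < v)))
      simpa using this
    rw [FI.mem_def] at hμv' hμu' hiLu' hiLv1'
    have hratio_v : 0 ≤ ((v : ℝ) - u) / (v * Real.log v) := by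
      apply div_nonneg
      · have : (u : ℝ) ≤ v := by exact_mod_cast huv.le
        linarith
      · positivity
    -- (m) the lower sum
    have hsum_m : (mlo : ℝ) / SC * (((v : ℝ) - u) / (v * Real.log v)) ≤
        ∑ n ∈ Finset.Ioc u v, envTermm P n := by
      calc (mlo : ℝ) / SC * (((v : ℝ) - u) / (v * Real.log v))
          ≤ (mlo : ℝ) / SC * ∑ n ∈ Finset.Ioc u v, 1 / ((n : ℝ) * Real.log n) :=
            mul_le_mul_of_nonneg_left (sum_inv_mul_log_ge hu2 huv.le) (by positivity)
        _ = ∑ n ∈ Finset.Ioc u v, (mlo : ℝ) / SC * (1 / ((n : ℝ) * Real.log n)) := by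
            rw [Finset.mul_sum]
        _ ≤ ∑ n ∈ Finset.Ioc u v, envTermm P n := by
            refine Finset.sum_le_sum fun n hn ↦ ?_
            rw [Finset.mem_Ioc] at hn
            have hn0 : (2 : ℝ) < n := by
              have : (u : ℝ) + 1 ≤ n := by exact_mod_cast hn.1
              linarith
            have hlogn : 0 < Real.log n := Real.log_pos (by linarith)
            unfold envTermm
            rw [div_eq_mul_one_div ‖Hk P (kOf P n)‖]
            exact mul_le_mul_of_nonneg_right (hHlo n hn.1 hn.2) (by positivity)
    -- (M) the upper sum
    have hsum_M : ∑ n ∈ Finset.Ioc u v, envTermM P n ≤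
        (Mhi : ℝ) / SC * (((v : ℝ) - u) / (u * Real.log u)) := by
      calc ∑ n ∈ Finset.Ioc u v, envTermM P n
          ≤ ∑ n ∈ Finset.Ioc u v, (Mhi : ℝ) / SC * (1 / (((n : ℝ) - 1) * Real.log n)) := by
            refine Finset.sum_le_sum fun n hn ↦ ?_
            rw [Finset.mem_Ioc] at hn
            have hn1 : (u : ℝ) ≤ (n : ℝ) - 1 := by
              have : ((u + 1 : ℕ) : ℝ) ≤ n := by exact_mod_cast hn.1
              push_cast at this; linarith
            have hn0 : (2 : ℝ) < n := by linarith
            have hlogn : 0 < Real.log n := Real.log_pos (by linarith)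
            unfold envTermM
            rw [div_eq_mul_one_div ‖Hk P (kOf P n)‖]
            exact mul_le_mul_of_nonneg_right (hHhi n hn.1 hn.2) (by
              apply div_nonneg zero_le_one; apply mul_nonneg <;> linarith)
        _ = (Mhi : ℝ) / SC * ∑ n ∈ Finset.Ioc u v, 1 / (((n : ℝ) - 1) * Real.log n) := by
            rw [Finset.mul_sum]
        _ ≤ (Mhi : ℝ) / SC * (((v : ℝ) - u) / (u * Real.log u)) :=
            mul_le_mul_of_nonneg_left (sum_inv_pred_mul_log_le hu2 huv.le) (by positivity)
    -- (R2) the variation sum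
    have hsum_R2 : ∑ n ∈ Finset.Ico u v, envTermR2 P n ≤
        (Mhi : ℝ) / SC * (1 / Real.log u - 1 / Real.log v) := by
      calc ∑ n ∈ Finset.Ico u v, envTermR2 P n
          ≤ ∑ n ∈ Finset.Ico u v, (Mhi : ℝ) / SC * (1 / Real.log n - 1 / Real.log ((n : ℝ) + 1)) := by
            refine Finset.sum_le_sum fun n hn ↦ ?_
            rw [Finset.mem_Ico] at hn
            have hn2 : (2 : ℝ) < n := by
              have : (u : ℝ) ≤ n := by exact_mod_cast hn.1
              linarith
            have hlogn : 0 < Real.log n := Real.log_pos (by linarith)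
            have hd : 0 ≤ 1 / Real.log n - 1 / Real.log ((n : ℝ) + 1) := by
              have : Real.log n ≤ Real.log ((n : ℝ) + 1) := Real.log_le_log (by linarith) (by linarith)
              have h1 := one_div_le_one_div_of_le hlogn this
              linarith
            unfold envTermR2
            exact mul_le_mul_of_nonneg_right (hHhi (n + 1) (by omega) (by omega)) hd
        _ = (Mhi : ℝ) / SC * (1 / Real.log u - 1 / Real.log v) := by
            rw [← Finset.mul_sum, sum_Ico_inv_log_sub u v huv.le]
    -- (P) the box of the main term
    have hsum_C1 : ((v : ℝ) - u) / (v * Real.log v) ≤ ∑ n ∈ Finset.Ioc u v, 1 / ((n : ℝ) * Real.log n) :=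
      sum_inv_mul_log_ge hu2 huv.le
    have hsum_C2 : ∑ n ∈ Finset.Ioc u v, 1 / ((n : ℝ) * Real.log n) ≤ ((v : ℝ) - u) / (u * Real.log u) :=
      sum_inv_mul_log_le hu2 huv.le
    have hCmem : FI.mem (∑ n ∈ Finset.Ioc u v, 1 / ((n : ℝ) * Real.log n)) ⟨μv.lo, μu.hi⟩ := by
      rw [FI.mem_def]
      constructor
      · push_cast
        calc (μv.lo : ℝ) ≤ ((v : ℝ) - u) / (v * Real.log v) * SC := hμv'.1
          _ ≤ _ := by gcongr
      · push_cast
        calc (∑ n ∈ Finset.Ioc u v, 1 / ((n : ℝ) * Real.log n)) * SC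
            ≤ ((v : ℝ) - u) / (u * Real.log u) * SC := by gcongr
          _ ≤ μu.hi := hμu'.2
    have hP0bin : CB.mem (∑ n ∈ Finset.Ioc u v, envTermP P n) (Z.mulFI ⟨μv.lo, μu.hi⟩) := by
      have heq : ∑ n ∈ Finset.Ioc u v, envTermP P n =
          ∑ n ∈ Finset.Ioc u v, (phase (τOf P) (Real.log n) * Hk P (kOf P n)) *
            ((1 / ((n : ℝ) * Real.log n) : ℝ) : ℂ) :=
        Finset.sum_congr rfl fun n hn ↦ by
          rw [Finset.mem_Ioc] at hn; exact envTermP_eq (by omega)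
      rw [heq]
      refine CBmem_weightedSum (Finset.Ioc u v) (fun n hn ↦ ?_) (fun n hn ↦ ?_) (hz v huv le_rfl) hCmem
      · rw [Finset.mem_Ioc] at hn
        have hn2 : (2 : ℝ) < n := by
          have : (u : ℝ) + 1 ≤ n := by exact_mod_cast hn.1
          linarith
        have hlogn : 0 < Real.log n := Real.log_pos (by linarith)
        positivity
      · rw [Finset.mem_Ioc] at hn; exact hz n hn.1 hn.2
    -- inverse logarithm bounds
    have hinvu : 1 / Real.log u ≤ (iLu.hi : ℝ) / SC := by
      rw [le_div_iff₀ hsc]; exact hiLu'.2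
    have hinvv : (iLv1.lo : ℝ) / SC ≤ 1 / Real.log v := by
      rw [div_le_iff₀ hsc]
      refine hiLv1'.1.trans ?_
      gcongr
      · exact le_add_of_nonneg_right (by positivity)
    have hiLuhi0 : (0 : ℝ) ≤ iLu.hi := by
      have : 0 < 1 / Real.log u := by positivity
      have := hiLu'.2; nlinarith
    refine ⟨hacc.ok, fun ht ↦ by simp at ht, hacc.Rtab0, fun _ ↦ hacc.RtabE rfl, fun ht ↦ by simp at ht,
      fun _ ↦ ?_, fun _ ↦ ?_, ?_, fun ht ↦ by simp at ht, fun _ ↦ ?_, ?_, fun ht ↦ by simp at ht,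
      fun _ ↦ ?_, ?_, fun ht ↦ by simp at ht, fun _ hux huh ↦ ?_, ?_, hmono', hmonoTab', hk'⟩
    · -- P0E
      rw [Ioc_split huv.le hvh, add_comm]
      exact CB.mem_add (hacc.P0E rfl) hP0bin
    · -- mainm
      push_cast
      rw [Ioc_split huv.le hvh, add_mul]
      have hold := hacc.mainm rfl
      have hnew : max (0 : ℝ) (((μv.lo * mlo / SCZ : ℤ)) : ℝ) ≤ (∑ n ∈ Finset.Ioc u v, envTermm P n) * SC := by
        have hS0 : 0 ≤ (∑ n ∈ Finset.Ioc u v, envTermm P n) * SC :=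
          mul_nonneg (le_trans (by positivity) hsum_m) hsc.le
        refine max_le hS0 ?_
        · refine cast_fdiv_le hSCZ ?_
          rw [SCZ_cast]
          push_cast
          have h1 : (μv.lo : ℝ) * mlo ≤ ((v : ℝ) - u) / (v * Real.log v) * SC * mlo :=
            mul_le_mul_of_nonneg_right hμv'.1 hmlo0r
          calc (μv.lo : ℝ) * mlo ≤ ((v : ℝ) - u) / (v * Real.log v) * SC * mlo := h1
            _ = ((mlo : ℝ) / SC * (((v : ℝ) - u) / (v * Real.log v))) * SC * SC := by
                field_simp
            _ ≤ (∑ n ∈ Finset.Ioc u v, envTermm P n) * SC * SC := by gcongr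
      linarith
    · -- mainm0
      exact add_nonneg hacc.mainm0 (le_max_left _ _)
    · -- mainM
      push_cast
      rw [Ioc_split huv.le hvh, add_mul]
      have hold := hacc.mainM rfl
      have hnew : (∑ n ∈ Finset.Ioc u v, envTermM P n) * SC ≤ ((cdiv (μu.hi * Mhi) SCZ : ℤ) : ℝ) := by
        refine le_cast_cdiv hSCZ ?_
        rw [SCZ_cast]
        push_cast
        have hratio : ((v : ℝ) - u) / (u * Real.log u) * SC ≤ μu.hi := hμu'.2
        calc (∑ n ∈ Finset.Ioc u v, envTermM P n) * SC * SC
            ≤ (Mhi : ℝ) / SC * (((v : ℝ) - u) / (u * Real.log u)) * SC * SC := by gcongr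
          _ = (((v : ℝ) - u) / (u * Real.log u) * SC) * Mhi := by field_simp
          _ ≤ (μu.hi : ℝ) * Mhi := mul_le_mul_of_nonneg_right hratio hMhi0
      linarith
    · -- mainM0
      refine add_nonneg hacc.mainM0 (cdiv_nonneg (mul_nonneg ?_ hMhi0') hSCZ)
      have : (0 : ℝ) ≤ μu.hi := by
        have h1 : 0 ≤ ((v : ℝ) - u) / (u * Real.log u) * SC := by
          apply mul_nonneg _ hsc.le
          apply div_nonneg
          · have : (u : ℝ) ≤ v := by exact_mod_cast huv.le
            linarith
          · positivity
        linarith [hμu'.2]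
      exact_mod_cast this
    · -- R2
      push_cast
      rw [Ico_split huv.le hvh, add_mul]
      have hold := hacc.R2 rfl
      have hnew : (∑ n ∈ Finset.Ico u v, envTermR2 P n) * SC ≤
          ((cdiv (Mhi * (iLu.hi - iLv1.lo)) SCZ : ℤ) : ℝ) := by
        refine le_cast_cdiv hSCZ ?_
        rw [SCZ_cast]
        push_cast
        calc (∑ n ∈ Finset.Ico u v, envTermR2 P n) * SC * SC
            ≤ (Mhi : ℝ) / SC * (1 / Real.log u - 1 / Real.log v) * SC * SC := by gcongr
          _ ≤ (Mhi : ℝ) / SC * ((iLu.hi : ℝ) / SC - iLv1.lo / SC) * SC * SC := by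
              gcongr (Mhi : ℝ) / SC * ?_ * SC * SC
              linarith
          _ = (Mhi : ℝ) * (iLu.hi - iLv1.lo) := by field_simp
      linarith
    · -- R20
      refine add_nonneg hacc.R20 (cdiv_nonneg (mul_nonneg hMhi0' ?_) hSCZ)
      have : (iLv1.lo : ℝ) / SC ≤ (iLu.hi : ℝ) / SC :=
        hinvv.trans ((one_div_le_one_div_of_le hlogu hloguv).trans hinvu)
      have : (iLv1.lo : ℝ) ≤ iLu.hi := by
        rw [div_le_div_iff_of_pos_right hsc] at this; exact this
      exact_mod_cast (sub_nonneg.2 this)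
    · -- GX
      have hi : i = max E.iX P.iY + 1 := hiX.2 hux
      have hb : Nat.beq i (max E.iX P.iY + 1) = true := by rw [Nat.beq_eq]; exact hi
      simp only [hb, Bool.cond_true]
      refine le_cast_cdiv hSCZ ?_
      rw [SCZ_cast]
      push_cast
      have h1 : ‖Hk P (kOf P (u + 1))‖ ≤ (Mhi : ℝ) / SC := hHhi (u + 1) (by omega) (by omega)
      have h2 : 1 / Real.log ((u : ℝ) + 1) ≤ (iLu.hi : ℝ) / SC := by
        refine le_trans ?_ hinvu
        exact one_div_le_one_div_of_le hlogu (Real.log_le_log (by positivity) (by linarith))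
      have h3 : 0 ≤ 1 / Real.log ((u : ℝ) + 1) := by
        have : 0 < Real.log ((u : ℝ) + 1) := Real.log_pos (by linarith)
        positivity
      calc ‖Hk P (kOf P (u + 1))‖ / Real.log ((u : ℝ) + 1) * SC * SC
          = ‖Hk P (kOf P (u + 1))‖ * (1 / Real.log ((u : ℝ) + 1)) * SC * SC := by ring
        _ ≤ (Mhi : ℝ) / SC * ((iLu.hi : ℝ) / SC) * SC * SC := by gcongr
        _ = (Mhi : ℝ) * iLu.hi := by field_simp
    · -- GX0
      cases hb : Nat.beq i (max E.iX P.iY + 1)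
      · simp only [Bool.cond_false]; exact hacc.GX0
      · simp only [Bool.cond_true]
        exact cdiv_nonneg (mul_nonneg hMhi0' (by exact_mod_cast hiLuhi0)) hSCZ
  · ---------------------------------------------------------------- table bin
    rw [htc] at hbranch hacc
    rw [hbranch] at h
    simp only [Bool.cond_true, Option.some.injEq] at h
    subst h
    have hcard : (binPrimes u v).card = c := by rw [card_binPrimes huv.le, hc htc]
    -- each prime of the bin
    have hprime : ∀ p ∈ binPrimes u v, u < p ∧ p ≤ v := fun p hp ↦ by
      simp only [binPrimes, Finset.mem_filter, Finset.mem_Ioc] at hp; exact hp.1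
    -- (R) the lower bound of the prime sum
    have hsumR : (c : ℝ) * ((mlo : ℝ) / SC / v) ≤ ∑ p ∈ binPrimes u v, tabTermR P p := by
      calc (c : ℝ) * ((mlo : ℝ) / SC / v) = ∑ _p ∈ binPrimes u v, (mlo : ℝ) / SC / v := by
            rw [Finset.sum_const, hcard, nsmul_eq_mul]
        _ ≤ ∑ p ∈ binPrimes u v, tabTermR P p := by
            refine Finset.sum_le_sum fun p hp ↦ ?_
            obtain ⟨hp1, hp2⟩ := hprime p hp
            unfold tabTermR
            have hp0 : (0 : ℝ) < p := by exact_mod_cast (by omega : 0 < p)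
            have hpv : (p : ℝ) ≤ v := by exact_mod_cast hp2
            calc (mlo : ℝ) / SC / v ≤ (mlo : ℝ) / SC / p := by
                  apply div_le_div_of_nonneg_left (by positivity) hp0 hpv
              _ ≤ ‖Hk P (kOf P p)‖ / p := by
                  gcongr; exact hHlo p hp1 hp2
    -- (P) the box of the prime sum
    have hw : ∀ p ∈ binPrimes u v, FI.mem ((p : ℝ)⁻¹) ⟨SCZ / v, cdiv SCZ (u + 1)⟩ := by
      intro p hp
      obtain ⟨hp1, hp2⟩ := hprime p hp
      have hp0 : (0 : ℝ) < p := by exact_mod_cast (by omega : 0 < p)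
      rw [FI.mem_def]
      constructor
      · push_cast
        refine cast_fdiv_le (by exact_mod_cast (by omega : 0 < v)) ?_
        rw [SCZ_cast]
        push_cast
        have hpv : (p : ℝ) ≤ v := by exact_mod_cast hp2
        have h1 : (1 : ℝ) ≤ (p : ℝ)⁻¹ * v := by rw [inv_mul_eq_div, one_le_div hp0]; exact hpv
        calc (SC : ℝ) = 1 * SC := (one_mul _).symm
          _ ≤ ((p : ℝ)⁻¹ * v) * SC := by gcongr
          _ = (p : ℝ)⁻¹ * SC * v := by ring
      · push_cast
        refine le_cast_cdiv (by exact_mod_cast (by omega : 0 < u + 1)) ?_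
        rw [SCZ_cast]
        push_cast
        have hpu : (u : ℝ) + 1 ≤ p := by exact_mod_cast hp1
        have h1 : (p : ℝ)⁻¹ * ((u : ℝ) + 1) ≤ 1 := by rw [inv_mul_eq_div, div_le_one hp0]; exact hpu
        calc (p : ℝ)⁻¹ * SC * ((u : ℝ) + 1) = ((p : ℝ)⁻¹ * ((u : ℝ) + 1)) * SC := by ring
          _ ≤ 1 * SC := by gcongr
          _ = SC := one_mul _
    have hP0bin : CB.mem (∑ p ∈ binPrimes u v, tabTermP P p)
        (((Z.mulFI ⟨SCZ / v, cdiv SCZ (u + 1)⟩)).mulInt c) := by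
      have heq : ∑ p ∈ binPrimes u v, tabTermP P p =
          ∑ p ∈ binPrimes u v, (phase (τOf P) (Real.log p) * Hk P (kOf P p)) * (((p : ℝ)⁻¹ : ℝ) : ℂ) :=
        Finset.sum_congr rfl fun p hp ↦ by
          obtain ⟨hp1, -⟩ := hprime p hp; exact tabTermP_eq (by omega)
      rw [heq, ← hcard]
      refine CBmem_sum_mulInt (binPrimes u v) (fun p hp ↦ ?_)
      obtain ⟨hp1, hp2⟩ := hprime p hp
      exact CB.mem_mulFI (hz p hp1 hp2) (hw p hp)
    refine ⟨hacc.ok, fun _ ↦ ?_, ?_, fun ht ↦ by simp at ht, fun _ ↦ ?_, fun ht ↦ by simp at ht,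
      fun ht ↦ by simp at ht, hacc.mainm0, fun _ ↦ hacc.mainmT rfl, fun ht ↦ by simp at ht, hacc.mainM0,
      fun _ ↦ hacc.mainMT rfl, fun ht ↦ by simp at ht, hacc.R20, fun _ ↦ hacc.R2T rfl,
      fun ht ↦ by simp at ht, hacc.GX0, hmono', hmonoTab', hk'⟩
    · -- Rtab
      push_cast
      rw [binPrimes_split huv.le hvh, add_mul]
      have hold := hacc.Rtab rfl
      have hnew : (((c : ℤ) * mlo / v : ℤ) : ℝ) ≤ (∑ p ∈ binPrimes u v, tabTermR P p) * SC := by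
        refine cast_fdiv_le (by exact_mod_cast (by omega : 0 < v)) ?_
        push_cast
        have hv0 : (0 : ℝ) < v := by exact_mod_cast (by omega : 0 < v)
        calc (c : ℝ) * mlo = (c : ℝ) * ((mlo : ℝ) / SC / v) * SC * v := by field_simp
          _ ≤ (∑ p ∈ binPrimes u v, tabTermR P p) * SC * v := by gcongr
      linarith
    · -- Rtab0
      refine add_nonneg hacc.Rtab0 (Int.ediv_nonneg (mul_nonneg (by positivity) hmlo0) (by positivity))
    · -- P0T
      rw [binPrimes_split huv.le hvh, add_comm]
      exact CB.mem_add (hacc.P0T rfl) hP0bin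

/-! ### One bin step preserves the invariant -/

/-- `forceOK` is always `true`. [folklore] -/
theorem forceOK_eq_true (o : ChunkOut) (Lu Lk' : FI) (Φu Ψk' : CB)
    (h1 : o.P0.re.lo ≤ o.P0.re.hi) (h2 : o.P0.im.lo ≤ o.P0.im.hi) (h3 : o.mainm ≤ o.mainM)
    (h4 : Lu.lo ≤ Lu.hi) (h5 : Lk'.lo ≤ Lk'.hi) (h6 : Φu.re.lo ≤ Φu.re.hi) (h7 : Φu.im.lo ≤ Φu.im.hi)
    (h8 : Ψk'.re.lo ≤ Ψk'.re.hi) (h9 : Ψk'.im.lo ≤ Ψk'.im.hi) : forceOK o Lu Lk' Φu Ψk' = true := by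
  unfold forceOK
  simp only [Bool.and_eq_true, decide_eq_true_eq]
  refine ⟨⟨⟨⟨⟨⟨⟨⟨⟨h1, h2⟩, le_rfl⟩, by omega⟩, h4⟩, h5⟩, h6⟩, h7⟩, h8⟩, h9⟩

/-- **One bin step.** [folklore] -/
theorem binStep_sound (ctx : ChunkCtx P E piTab tab Ψ0 top stop) {st st' : BinState}
    (inv : BinInv P E piTab top stop st) (hi : stop < st.i)
    (h : binStep P E tab Ψ0 (N1Of P) st = some st') :
    BinInv P E piTab top stop st' ∧ st'.i = st.i - 1 := by
  obtain ⟨hstop, htop⟩ := inv.i_mem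
  have hi1 : st.i = (st.i - 1) + 1 := by omega
  have hv : st.v = gridPt st.i := inv.v_eq
  have huv : gridPt (st.i - 1) < st.v := by
    rw [hv]; conv_rhs => rw [hi1]
    exact gridPt_lt_succ _
  have hu20 : 20 ≤ gridPt (st.i - 1) := twenty_le_gridPt _
  have hu0 : 0 < gridPt (st.i - 1) := by omega
  have hedges : st.edges = gridPt (st.i - 1) :: gridDesc stop (st.i - 1) := by
    rw [inv.edges]; conv_lhs => rw [hi1]
    rw [gridDesc_succ (by omega)]
  have hkpos : 0 < st.k := inv.k_pos
  have hk : st.k = N1Of P / st.v := inv.k_eq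
  have hkk' : st.k ≤ N1Of P / gridPt (st.i - 1) := by
    rw [hk]; exact Nat.div_le_div_left huv.le hu0
  have hvtop : st.v ≤ gridPt top := by rw [hv]; exact gridPt_strictMono.monotone htop
  -- unfold the step
  unfold binStep at h
  rw [hedges] at h
  simp only at h
  cases hg : (Nat.blt (N1Of P / gridPt (st.i - 1)) st.k || Nat.beq st.k 0 || Nat.ble st.v (gridPt (st.i - 1)))
  · rw [hg] at h
    simp only [Bool.cond_false] at h
    -- logarithms
    split at h
    rotate_left
    · simp at h
    rename_i Lu incrP Lk' incrK hlogD hlogU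
    obtain ⟨hLu, hincP⟩ := logDown_spec hlogD huv.le inv.Lv
    obtain ⟨hLk', hincK⟩ := logUp_spec hlogU hkk' (fun _ ↦ inv.Lk)
    -- phases
    split at h
    rotate_left
    · simp at h
    rename_i Φbin Φu Ψrange Ψk' kph' hphd hkph
    obtain ⟨hΦbin, hΦu⟩ := phaseDown_spec ctx.td_pos hphd inv.Φv hLu inv.Lv (fun D hD ↦ (hincP D hD).2)
    obtain ⟨hkph1, hkph2⟩ := kphaseOf_spec ctx.td_pos hkph inv.Lk hLk' inv.Ψk
      (fun D hD ↦ (hincK D hD).2)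
    -- the `H`-box
    have hHbox : ∀ j, st.k ≤ j → j ≤ N1Of P / gridPt (st.i - 1) →
        CB.mem (Hk P j) (hboxOf P tab Ψ0 Ψrange st.k (N1Of P / gridPt (st.i - 1))) := fun j hj1 hj2 ↦
      mem_hboxOf ctx.td_pos ctx.tn_pos ctx.k0_pos hkpos hkk'
        (fun hklt ↦ ctx.tabOK (by
          have : N1Of P / gridPt top ≤ N1Of P / st.v :=
            Nat.div_le_div_left hvtop (by rw [hv]; exact gridPt_pos _)
          rw [← hk] at this
          exact lt_of_le_of_lt this hklt))
        (fun hnot ↦ (hkph1 hnot).1) ctx.hk0 ctx.psi0 hj1 hj2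
    split at h
    rotate_left
    · simp at h
    rename_i mlo Mhi hmlo hMhi
    have hmlo0 : 0 ≤ mlo := (absLoCB_le hmlo (hHbox st.k le_rfl hkk')).1
    -- per `n` of the bin
    have hbin : ∀ n, gridPt (st.i - 1) < n → n ≤ st.v →
        CB.mem (phase (τOf P) (Real.log n) * Hk P (kOf P n))
          (Φbin.mul (hboxOf P tab Ψ0 Ψrange st.k (N1Of P / gridPt (st.i - 1)))) ∧
        (mlo : ℝ) ≤ ‖Hk P (kOf P n)‖ * SC ∧ ‖Hk P (kOf P n)‖ * SC ≤ (Mhi : ℝ) := by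
      intro n hn1 hn2
      obtain ⟨hk1, hk2⟩ := kOf_mem (P := P) hu0 hn1 hn2
      rw [← hk] at hk1
      obtain ⟨hl1, hl2⟩ := log_mem (by omega) hn1 hn2
      exact ⟨CB.mem_mul (hΦbin _ hl1 hl2) (hHbox _ hk1 hk2),
        (absLoCB_le hmlo (hHbox _ hk1 hk2)).2, le_absHiCB hMhi (hHbox _ hk1 hk2)⟩
    -- the accumulators
    split at h
    rotate_left
    · simp at h
    rename_i o' hacc'
    -- forcing
    cases hf : forceOK o' Lu Lk' Φu Ψk'
    · rw [hf] at h; simp at h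
    · rw [hf] at h
      simp only [Bool.cond_true, Option.some.injEq] at h
      subst h
      -- table facts
      have htabC : Nat.ble st.i E.iX = decide (top ≤ E.iX) := by
        rcases ctx.region with ⟨h1, -⟩ | h2
        · have : st.i ≤ E.iX := htop.trans h1
          rw [show decide (top ≤ E.iX) = true by simpa using h1]
          simpa [Nat.ble_eq] using this
        · have hnot : ¬ top ≤ E.iX := by omega
          rw [show decide (top ≤ E.iX) = false by simpa using hnot]
          have : ¬ st.i ≤ E.iX := by omega
          cases hb : Nat.ble st.i E.iX
          · rfl
          · exact absurd (by simpa [Nat.ble_eq] using hb) this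
      have hpis : top ≤ E.iX → st.pis = piTab.getD (st.i - 1) 0 :: pisList piTab stop (st.i - 1) ∧
          piTab.getD (st.i - 1) 0 = Nat.primeCounting (gridPt (st.i - 1)) := by
        intro htab
        rcases ctx.region with ⟨h1, hlen⟩ | h2
        · refine ⟨?_, ctx.pi (st.i - 1) (by omega) (by omega)⟩
          rw [inv.pis htab]
          conv_lhs => rw [hi1]
          exact pisList_succ piTab (by omega) (by omega)
        · omega
      have hacc := accUpdate_spec (P := P) (tabC := decide (top ≤ E.iX)) hacc' htabC
        (by
          constructor
          · intro hix; congr 1; omega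
          · intro hgeq
            have := gridPt_strictMono.injective hgeq
            omega)
        inv.acc hu20 huv hvtop (fun n h1 h2 ↦ (hbin n h1 h2).1) (fun n h1 h2 ↦ (hbin n h1 h2).2) hmlo0
        hLu inv.Lv
        (by
          intro htab
          have htab' : top ≤ E.iX := by simpa using htab
          obtain ⟨hpl, hval⟩ := hpis htab'
          rw [inv.piv htab', hpl, List.headD_cons, hval])
        (fun hmb j hj1 hj0 hj2 ↦ by
          rw [← hk] at hj1
          exact monoBinOf_spec hmb hkpos hHbox
            (fun hk0' ↦ (hkph1 (fun hh ↦ (Nat.lt_irrefl _ (lt_of_lt_of_le hk0' hh.1)).elim)).1)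
            hj1 hj0 hj2)
        rfl
      refine ⟨⟨⟨Nat.le_sub_one_of_lt hi, (Nat.sub_le _ _).trans htop⟩, rfl, hLu, hΦu, rfl,
        lt_of_lt_of_le hkpos hkk', hLk', fun hk' ↦ hkph2 hk', rfl, fun htab ↦ ?_, fun htab ↦ ?_, hacc⟩, rfl⟩
      · -- piv
        obtain ⟨hpl, hval⟩ := hpis htab
        have hps : pisList piTab stop st.i = piTab.getD (st.i - 1) 0 :: pisList piTab stop (st.i - 1) := by
          rw [← inv.pis htab]; exact hpl
        show st.pis.headD 0 = Nat.primeCounting (gridPt (st.i - 1))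
        rw [hpl, List.headD_cons, hval]
      · -- pis
        obtain ⟨hpl, -⟩ := hpis htab
        show st.pis.tail = pisList piTab stop (st.i - 1)
        rw [hpl, List.tail_cons]
  · rw [hg] at h; simp at h

/-! ### The walk and the chunk -/

/-- **The bin walk.** [folklore] -/
theorem binsGo_sound (ctx : ChunkCtx P E piTab tab Ψ0 top stop) :
    ∀ (fuel : ℕ) (st st'' : BinState), BinInv P E piTab top stop st → st.i - stop ≤ fuel →
      binsGo P E tab Ψ0 (N1Of P) stop fuel st = some st'' → BinInv P E piTab top stop st'' ∧ st''.i = stop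
  | 0, st, st'', inv, hfuel, h => by
    simp only [binsGo, Option.some.injEq] at h
    subst h
    exact ⟨inv, by have := inv.i_mem.1; omega⟩
  | fuel + 1, st, st'', inv, hfuel, h => by
    rw [binsGo] at h
    cases hle : Nat.ble st.i stop
    · rw [hle] at h
      simp only [Bool.cond_false] at h
      have hgt : stop < st.i := lt_of_ble_false hle
      split at h
      · rename_i st' hst'
        obtain ⟨inv', hi'⟩ := binStep_sound ctx inv hgt hst'
        exact binsGo_sound ctx fuel st' st'' inv' (by rw [hi']; omega) h
      · simp at h
    · rw [hle] at h
      simp only [Bool.cond_true, Option.some.injEq] at h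
      subst h
      have h1 : st.i ≤ stop := by simpa [Nat.ble_eq] using hle
      exact ⟨inv, le_antisymm h1 inv.i_mem.1⟩

/-- `phasePt P n = some (L, B)` gives `L ∋ log n` and `B ∋ n^{-iτ}`. [folklore] -/
theorem phasePt_spec (htd : 0 < P.td) {n : ℕ} {L : FI} {B : CB} (h : phasePt P n = some (L, B)) :
    FI.mem (Real.log n) L ∧ CB.mem (phase (τOf P) (Real.log n)) B := by
  unfold phasePt at h
  split at h
  · rename_i L' hL'
    have hm := mem_logFI hL'
    split at h
    · rename_i B' hB'
      simp only [Option.some.injEq, Prod.mk.injEq] at h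
      obtain ⟨rfl, rfl⟩ := h
      have hm' := hm
      rw [FI.mem_def] at hm'
      exact ⟨hm, mem_phaseBox htd hB' hm'.1 hm'.2⟩
    · simp at h
  · simp at h

/-- The initial accumulators (empty range). [folklore] -/
theorem accBounds_init {tabC : Bool} {hi k : ℕ} (hk : k = N1Of P / hi) {flag : Bool}
    (hflag : flag = true → N1Of P / hi < P.k0 → ∀ j, 2 ≤ j → j ≤ P.k0 → ‖Hk P (j - 1)‖ ≤ ‖Hk P j‖) :
    AccBounds P E tabC hi hi ⟨true, 0, 0, 0, 0, CB.ofInt 0, 0, 0, flag, k⟩ where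
  ok := rfl
  Rtab _ := by simp [binPrimes]
  Rtab0 := le_rfl
  RtabE _ := rfl
  P0T _ := by
    have : binPrimes hi hi = ∅ := by simp [binPrimes]
    rw [this, Finset.sum_empty]; exact_mod_cast CB.mem_ofInt 0
  P0E _ := by rw [Finset.Ioc_self, Finset.sum_empty]; exact_mod_cast CB.mem_ofInt 0
  mainm _ := by simp
  mainm0 := le_rfl
  mainmT _ := rfl
  mainM _ := by simp
  mainM0 := le_rfl
  mainMT _ := rfl
  R2 _ := by simp
  R20 := le_rfl
  R2T _ := rfl
  GX _ _ hlt := absurd hlt (lt_irrefl _)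
  GX0 := le_rfl
  mono _ j h1 _ h3 := by omega
  monoTab := hflag
  kcert := hk

/-- The global hypotheses of a window that every chunk needs. [folklore] -/
structure WinCtx (P : WinParams) (E : EnvConsts) (piTab : List ℕ) : Prop where
  /-- `0 < td` -/
  td_pos : 0 < P.td
  /-- `0 < tn` -/
  tn_pos : 0 < P.tn
  /-- `1 ≤ k₀` -/
  k0_pos : 1 ≤ P.k0
  /-- `Hk0 ∋ H_{k₀}(s)` -/
  hk0 : CB.mem (Hk P P.k0) P.Hk0
  /-- the prime-count table is correct up to `i_X` -/
  pi : PiTabOK piTab E.iX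

/-- Meaning of the chunk guard. [folklore] -/
theorem chunkGuard_false {c : ℕ} (h : chunkGuard P E piTab c = false) :
    P.splits.getD (c + 1) 0 < P.splits.getD c 0 ∧ P.splits.getD c 0 ≤ P.i1 ∧
    P.iY ≤ P.splits.getD (c + 1) 0 ∧ 0 < P.k0 ∧ 0 < P.tn ∧ 0 < P.td ∧
    ((P.splits.getD c 0 ≤ E.iX ∧ P.splits.getD c 0 < piTab.length) ∨ E.iX ≤ P.splits.getD (c + 1) 0) := by
  unfold chunkGuard at h
  simp only [Bool.or_eq_false_iff] at h
  obtain ⟨⟨⟨⟨⟨⟨⟨h1, h2⟩, h3⟩, h4⟩, h5⟩, h6⟩, h7⟩, h8⟩ := h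
  have h4' := Nat.ne_of_beq_eq_false h4
  have h5' := Nat.ne_of_beq_eq_false h5
  have h6' := Nat.ne_of_beq_eq_false h6
  refine ⟨lt_of_ble_false h1, le_of_blt_false h2, le_of_blt_false h3, by omega, by omega, by omega, ?_⟩
  rw [Bool.not_eq_false', Bool.or_eq_true, Nat.ble_eq, Nat.ble_eq] at h7
  rw [Bool.and_eq_false_iff] at h8
  rcases h7 with ht | he
  · left
    refine ⟨ht, ?_⟩
    rcases h8 with h8 | h8
    · have : Nat.ble (P.splits.getD c 0) E.iX = true := by rw [Nat.ble_eq]; exact ht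
      rw [h8] at this; simp at this
    · have := le_of_blt_false h8; omega
  · exact Or.inr he

/-- Meaning of the `Hk0` check. [folklore] -/
theorem hk0Check_spec (htd : 0 < P.td) {tab : List CB} {tabMono : Bool}
    (htab : hTab P.tn P.td P.k0 = some (tab, tabMono)) (h : hk0Check P true tab = true) :
    CB.mem (Hk P P.k0) P.Hk0 := by
  unfold hk0Check at h
  simp only [Bool.not_true, Bool.false_or] at h
  obtain ⟨hlen, hget, -⟩ := hTab_spec htd htab
  cases tab with
  | nil => simp at h
  | cons H rest =>
    simp only [Bool.and_eq_true, decide_eq_true_eq] at h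
    obtain ⟨⟨⟨h1, h2⟩, h3⟩, h4⟩ := h
    have hk0pos : 1 ≤ P.k0 := by
      rcases Nat.eq_zero_or_pos P.k0 with h0 | h0
      · simp [h0] at hlen
      · exact h0
    have hmem := hget P.k0 hk0pos le_rfl
    unfold hTabGet at hmem
    simp only [Nat.sub_self, List.getD_cons_zero] at hmem
    obtain ⟨hre, him⟩ := hmem
    rw [FI.mem_def] at hre him
    refine ⟨⟨?_, ?_⟩, ⟨?_, ?_⟩⟩
    · exact le_trans (by exact_mod_cast h1) hre.1
    · exact le_trans hre.2 (by exact_mod_cast h2)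
    · exact le_trans (by exact_mod_cast h3) him.1
    · exact le_trans him.2 (by exact_mod_cast h4)

/-- **The initial data of a chunk.** If `chunkInit` succeeds then (i) the claimed `Hk0` is correct
whenever the chunk's first `k` is below `k₀`, and (ii) given the window hypotheses, the chunk context
holds and the initial state satisfies the invariant at `i = top`. [folklore] -/
theorem chunkInit_spec (htd : 0 < P.td) {c : ℕ} {tab : List CB} {Ψ0 : CB} {st0 : BinState}
    (h : chunkInit P E piTab c = some (tab, Ψ0, st0)) :
    (N1Of P / gridPt (P.splits.getD c 0) < P.k0 → CB.mem (Hk P P.k0) P.Hk0) ∧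
    (WinCtx P E piTab →
      ChunkCtx P E piTab tab Ψ0 (P.splits.getD c 0) (P.splits.getD (c + 1) 0) ∧
      BinInv P E piTab (P.splits.getD c 0) (P.splits.getD (c + 1) 0) st0 ∧
      st0.i = P.splits.getD c 0) := by
  unfold chunkInit at h
  simp only at h
  cases hg : chunkGuard P E piTab c
  · rw [hg] at h
    simp only [Bool.cond_false] at h
    obtain ⟨hts, hti1, hsY, hk0p, htnp, htdp, hregion⟩ := chunkGuard_false hg
    cases hk0 : Nat.beq (gridPt P.i1 / gridPt (P.splits.getD c 0)) 0
    · rw [hk0] at h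
      simp only [Bool.cond_false] at h
      have hkpos : 0 < gridPt P.i1 / gridPt (P.splits.getD c 0) :=
        Nat.pos_of_ne_zero (Nat.ne_of_beq_eq_false hk0)
      split at h
      rotate_left
      · simp at h
      rename_i tab' tabMono L0 Ψ0' Lv Φv Lk Ψk htab hp0 hpv hpk
      cases hck : hk0Check P (Nat.blt (gridPt P.i1 / gridPt (P.splits.getD c 0)) P.k0) tab'
      · rw [hck] at h; simp at h
      · rw [hck] at h
        simp only [Bool.cond_true, Option.some.injEq, Prod.mk.injEq] at h
        obtain ⟨rfl, rfl, rfl⟩ := h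
        -- (i) the `Hk0` check
        have hk0mem : N1Of P / gridPt (P.splits.getD c 0) < P.k0 → CB.mem (Hk P P.k0) P.Hk0 := by
          intro hneed
          have hnt : Nat.blt (gridPt P.i1 / gridPt (P.splits.getD c 0)) P.k0 = true := by
            rw [Nat.blt_eq]; exact hneed
          rw [hnt] at htab hck
          simp only [Bool.cond_true] at htab
          exact hk0Check_spec htd htab hck
        refine ⟨hk0mem, fun W ↦ ?_⟩
        -- the table, when needed
        have htabOK : N1Of P / gridPt (P.splits.getD c 0) < P.k0 →
            ∀ k, 1 ≤ k → k ≤ P.k0 → CB.mem (Hk P k) (hTabGet tab' P.k0 k) := by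
          intro hneed
          have hnt : Nat.blt (gridPt P.i1 / gridPt (P.splits.getD c 0)) P.k0 = true := by
            rw [Nat.blt_eq]; exact hneed
          rw [hnt] at htab
          simp only [Bool.cond_true] at htab
          exact (hTab_spec htd htab).2.1
        have hflag : (tabMono || !Nat.blt (gridPt P.i1 / gridPt (P.splits.getD c 0)) P.k0) = true →
            N1Of P / gridPt (P.splits.getD c 0) < P.k0 →
            ∀ j, 2 ≤ j → j ≤ P.k0 → ‖Hk P (j - 1)‖ ≤ ‖Hk P j‖ := by
          intro hf hneed
          have hnt : Nat.blt (gridPt P.i1 / gridPt (P.splits.getD c 0)) P.k0 = true := by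
            rw [Nat.blt_eq]; exact hneed
          rw [hnt] at htab hf
          simp only [Bool.cond_true] at htab
          simp only [Bool.not_true, Bool.or_false] at hf
          rw [hf] at htab
          exact (hTab_spec htd htab).2.2 rfl
        obtain ⟨-, hΨ0⟩ := phasePt_spec htd hp0
        obtain ⟨hLv, hΦv⟩ := phasePt_spec htd hpv
        obtain ⟨hLk, hΨk⟩ := phasePt_spec htd hpk
        refine ⟨⟨W.td_pos, W.tn_pos, W.k0_pos, htabOK, hΨ0, W.hk0, W.pi, hregion, ⟨hsY, hts, hti1⟩⟩, ?_, rfl⟩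
        refine ⟨⟨hts.le, le_rfl⟩, rfl, hLv, hΦv, rfl, hkpos, hLk, fun _ ↦ hΨk, rfl, fun htop ↦ ?_,
          fun htop ↦ ?_, accBounds_init rfl hflag⟩
        · -- piv
          rcases hregion with ⟨h1, hlen⟩ | h2
          · have hb : Nat.ble (P.splits.getD c 0) E.iX = true := by rw [Nat.ble_eq]; exact htop
            simp only [hb, Bool.cond_true]
            have := pisList_succ piTab (a := P.splits.getD (c + 1) 0) (i := P.splits.getD c 0) hts.le hlen
            unfold pisList at this
            rw [show P.splits.getD c 0 + 1 - P.splits.getD (c + 1) 0 =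
              P.splits.getD c 0 - P.splits.getD (c + 1) 0 + 1 by omega] at this
            rw [this, List.headD_cons]
            exact W.pi _ htop hlen
          · omega
        · -- pis
          rcases hregion with ⟨h1, hlen⟩ | h2
          · have hb : Nat.ble (P.splits.getD c 0) E.iX = true := by rw [Nat.ble_eq]; exact htop
            simp only [hb, Bool.cond_true]
            have := pisList_succ piTab (a := P.splits.getD (c + 1) 0) (i := P.splits.getD c 0) hts.le hlen
            unfold pisList at this ⊢
            rw [show P.splits.getD c 0 + 1 - P.splits.getD (c + 1) 0 =
              P.splits.getD c 0 - P.splits.getD (c + 1) 0 + 1 by omega] at this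
            rw [this, List.tail_cons]
          · omega
    · rw [hk0] at h; simp at h
  · rw [hg] at h; simp at h

/-- **Soundness of one chunk.** If chunk `c` passes, its output bounds the sums over `(g_stop, g_top]`
(`top = splits[c]`, `stop = splits[c+1]`), and the claimed `Hk0` is correct when the chunk builds the
table. [folklore] -/
theorem chunkOut_sound {c : ℕ} (htd : 0 < P.td) (hok : (chunkOut P E piTab c).ok = true) :
    (N1Of P / gridPt (P.splits.getD c 0) < P.k0 → CB.mem (Hk P P.k0) P.Hk0) ∧
    (WinCtx P E piTab →
      P.splits.getD (c + 1) 0 < P.splits.getD c 0 ∧ P.splits.getD c 0 ≤ P.i1 ∧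
      P.iY ≤ P.splits.getD (c + 1) 0 ∧
      AccBounds P E (decide (P.splits.getD c 0 ≤ E.iX)) (gridPt (P.splits.getD (c + 1) 0))
        (gridPt (P.splits.getD c 0)) (chunkOut P E piTab c)) := by
  unfold chunkOut at hok ⊢
  split at hok
  · simp [ChunkOut.fail] at hok
  · rename_i tab Ψ0 st0 hinit
    dsimp only at hok
    obtain ⟨hk0mem, hrest⟩ := chunkInit_spec htd hinit
    refine ⟨hk0mem, fun W ↦ ?_⟩
    obtain ⟨ctx, inv0, hi0⟩ := hrest W
    obtain ⟨hsY, hts, hti1⟩ := ctx.bounds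
    split at hok
    · rename_i st hwalk
      simp only [hwalk]
      cases hend : Nat.beq st.i (P.splits.getD (c + 1) 0)
      · rw [hend] at hok; simp [ChunkOut.fail] at hok
      · simp only [Bool.cond_true]
        obtain ⟨inv, hi⟩ := binsGo_sound ctx _ st0 st inv0 (by rw [hi0]) hwalk
        refine ⟨hts, hti1, hsY, ?_⟩
        have := inv.acc
        rw [inv.v_eq, hi] at this
        exact this
    · simp [ChunkOut.fail] at hok

end Pieces

end Literature.Barriers.RiemannHypothesis.TuranWindow
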